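import Summits.Ventures.PercRepro.S1TriangleCountSharp
import Summits.Ventures.PercRepro.S1FourCircuitCountSharpA
import Summits.Ventures.PercRepro.RankLevelSetCorankFiveCounts

/-!
# PercRepro — THE SHARPER TRIANGLE COUNT AT BOUNDED NULLITY, PART A: the rigid structure (p8, gen 19; a feeder for S4 — the
top of the `q = 7` window, the row `65`)

THE SHARP COUNT (S1TriangleCountSharp: `2·s₃ ≤ ν(ν − 1) + 2`) pays `t_e = ν − 1` for the triangles through the deleted
point `e` at every step of its deletion induction. When `t_x = ν − 1` with a triangle `T` avoiding `x` the matroid is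
RIGID: the set `W = T ∪ {x} ∪ ⋃(triangles through x)` carries the whole nullity, so every circuit lies inside `W`; deleting
one point of every triangle through `x` — off `T`, and off a second triangle `T₂` avoiding `x` whenever `T₂` does not
CONFLICT with `T` — keeps the rank and leaves a matroid of nullity `1`, which has ONE circuit. Hence every triangle
`T₂ ≠ T` avoiding `x` conflicts with `T`: some triangle `C` through `x` meets `T` at a point `a` and `T₂` at a different
point `b` (the partner of `a` on `{x, a, b}`).
* **`two_le_of_two_circuits`** — a finite matroid with two distinct circuits has nullity `≥ 2`;
* **`exists_partner_of_avoid_of_tight`** — the conflict.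
Part B (S1TriangleCountSharperB) draws `t_y ≤ 4` for `y ∈ T` and the count `2·s₃ + 3ν ≤ ν² + 12`. Axioms: standard.
-/

open scoped Matroid

namespace PercRepro

namespace S1

open Set

variable {α : Type}

/-- **Two distinct circuits force nullity `≥ 2`**: `c ∈ C₁ ∖ C₂` and `t ∈ C₂ ∖ C₁` both lie in the closure of
`(C₁ ∪ C₂) ∖ {c, t}`, so `r(C₁ ∪ C₂) ≤ |C₁ ∪ C₂| − 2`. -/
theorem two_le_of_two_circuits (K : Matroid α) [K.Finite] {C₁ C₂ : Set α} (h₁ : K.IsCircuit C₁)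
    (h₂ : K.IsCircuit C₂) (hne : C₁ ≠ C₂) {d : ℕ} (hd : K.E.encard = K.eRank + d) : 2 ≤ d := by
  classical
  have h12 : ¬ C₁ ⊆ C₂ := fun h => hne (h₁.eq_of_subset_isCircuit h₂ h)
  have h21 : ¬ C₂ ⊆ C₁ := fun h => hne (h₂.eq_of_subset_isCircuit h₁ h).symm
  obtain ⟨c, hcC₁, hcC₂⟩ := not_subset.1 h12
  obtain ⟨t, htC₂, htC₁⟩ := not_subset.1 h21
  have hct : c ≠ t := fun h => hcC₂ (h ▸ htC₂)
  set X := C₁ ∪ C₂ with hX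
  have hXE : X ⊆ K.E := union_subset h₁.subset_ground h₂.subset_ground
  have hXfin : X.Finite := K.ground_finite.subset hXE
  set Y := X \ {c, t} with hY
  have hYX : Y ⊆ X := sdiff_subset
  -- `X ⊆ cl Y`
  have hXcl : X ⊆ K.closure Y := by
    have hc : c ∈ K.closure Y := by
      have h := h₁.mem_closure_sdiff_singleton_of_mem hcC₁
      refine K.closure_subset_closure ?_ h
      intro z hz
      refine ⟨subset_union_left hz.1, ?_⟩
      intro hz'
      rcases hz' with rfl | rfl
      · exact hz.2 rfl
      · exact htC₁ hz.1
    have ht : t ∈ K.closure Y := by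
      have h := h₂.mem_closure_sdiff_singleton_of_mem htC₂
      refine K.closure_subset_closure ?_ h
      intro z hz
      refine ⟨subset_union_right hz.1, ?_⟩
      intro hz'
      rcases hz' with rfl | rfl
      · exact hcC₂ hz.1
      · exact hz.2 rfl
    intro z hz
    by_cases hzc : z = c
    · rw [hzc]; exact hc
    by_cases hzt : z = t
    · rw [hzt]; exact ht
    exact K.subset_closure Y (hYX.trans hXE) ⟨hz, fun h => by rcases h with h | h <;> [exact hzc h; exact hzt h]⟩
  have hrX : K.eRk X ≤ K.eRk Y := by
    calc K.eRk X ≤ K.eRk (K.closure Y) := K.eRk_mono hXcl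
      _ = K.eRk Y := K.eRk_closure_eq _
  have hYcard : Y.ncard + 2 = X.ncard := by
    have hpair : ({c, t} : Set α) ⊆ X :=
      insert_subset (subset_union_left hcC₁) (singleton_subset_iff.2 (subset_union_right htC₂))
    have h := ncard_sdiff hpair
    rw [ncard_pair hct] at h
    have h2 : ({c, t} : Set α).ncard ≤ X.ncard := ncard_le_ncard hpair hXfin
    rw [ncard_pair hct] at h2
    rw [hY]; omega
  -- nullity is monotone
  have hmono := PercRepro.Matroid.encard_le_eRk_add_of_encard_eq hXE hd
  have hYle : K.eRk Y ≤ (Y.ncard : ℕ∞) := by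
    have := K.eRk_le_encard Y
    rwa [← (hXfin.subset hYX).cast_ncard_eq] at this
  rw [← hXfin.cast_ncard_eq] at hmono
  have h3 : (X.ncard : ℕ∞) ≤ (Y.ncard : ℕ∞) + d := by
    calc (X.ncard : ℕ∞) ≤ K.eRk X + d := hmono
      _ ≤ (Y.ncard : ℕ∞) + d := by gcongr; exact hrX.trans hYle
  have h4 : X.ncard ≤ Y.ncard + d := by exact_mod_cast h3
  omega

/-- **The rigid structure**: if `t_x + 1 = d` (every nullity unit is spent by the triangles through `x` and one triangle
`T` avoiding `x`), then every triangle `T₂ ≠ T` avoiding `x` CONFLICTS with `T`: some triangle `C` through `x` meets `T`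
at a point `a` and `T₂` at a different point `b` (the partner of `a`). Otherwise one point of every triangle through `x`
can be deleted off both `T` and `T₂`, keeping the rank: a matroid of nullity `1` with two circuits. -/
theorem exists_partner_of_avoid_of_tight (M : Matroid α) [M.Finite]
    (hC1 : ∀ L ⊆ M.E, M.eRk L = 2 → L.ncard ≤ 3) {x : α} (hx : M.IsNonloop x)
    {T : Set α} (hT : T ∈ ThmN.triangles M) (hxT : x ∉ T) {d : ℕ}
    (hd : M.E.encard = M.eRank + d) (htight : (ThmN.trianglesThrough M x).ncard + 1 = d)
    {T₂ : Set α} (hT₂ : T₂ ∈ ThmN.triangles M) (hxT₂ : x ∉ T₂) (hne : T₂ ≠ T) :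
    ∃ C ∈ ThmN.trianglesThrough M x, ∃ a ∈ C, a ∈ T ∧ ∃ b ∈ C, b ∈ T₂ ∧ a ≠ b := by
  classical
  by_contra hcon
  have hxE : x ∈ M.E := hx.mem_ground
  have hTE : T ⊆ M.E := hT.1.subset_ground
  have hT₂E : T₂ ⊆ M.E := hT₂.1.subset_ground
  -- a triangle through `x` meets `T` (resp. `T₂`) in at most one point: else `x ∈ cl T`
  have hmeet : ∀ C ∈ ThmN.trianglesThrough M x, ∀ T' ∈ ThmN.triangles M, x ∉ T' →
      ∀ u ∈ C, ∀ v ∈ C, u ∈ T' → v ∈ T' → u = v := by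
    intro C hC T' hT' hxT' u hu v hv huT' hvT'
    by_contra huv
    have hux : u ≠ x := fun h => hxT' (h ▸ huT')
    have hvx : v ≠ x := fun h => hxT' (h ▸ hvT')
    have hCfin : C.Finite := M.ground_finite.subset hC.1.subset_ground
    have hCeq : C = {x, u, v} := by
      symm
      refine eq_of_subset_of_ncard_le ?_ ?_ hCfin
      · intro z hz
        rcases hz with rfl | rfl | rfl
        · exact hC.2.2
        · exact hu
        · exact hv
      · rw [hC.2.1, ncard_insert_of_notMem, ncard_pair huv]
        intro h
        rcases h with h | h
        · exact hux h.symm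
        · exact hvx (mem_singleton_iff.1 h).symm
    have hxcl : x ∈ M.closure (C \ {x}) := hC.1.mem_closure_sdiff_singleton_of_mem hC.2.2
    have hsub : C \ {x} ⊆ T' := by
      intro z hz
      have hzC : z ∈ C := hz.1
      rw [hCeq] at hzC
      rcases hzC with rfl | rfl | rfl
      · exact absurd rfl hz.2
      · exact huT'
      · exact hvT'
    have hxT'cl : x ∈ M.closure T' := M.closure_subset_closure hsub hxcl
    have hT'r : M.eRk T' = 2 := eRk_eq_two_of_ncard_three_circuit M hT'.1 hT'.2
    have h1 : M.eRk (insert x T') = 2 := by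
      rw [← M.eRk_closure_eq, Matroid.closure_insert_eq_of_mem_closure hxT'cl, M.eRk_closure_eq, hT'r]
    have h2 := hC1 (insert x T') (insert_subset hxE hT'.1.subset_ground) h1
    rw [ncard_insert_of_notMem hxT' (M.ground_finite.subset hT'.1.subset_ground), hT'.2] at h2
    omega
  -- the point to delete from each triangle `C` through `x`: in `C ∖ {x}`, off `T` and off `T₂`
  have hchoice : ∀ C ∈ ThmN.trianglesThrough M x, ∃ b ∈ C, b ≠ x ∧ b ∉ T ∧ b ∉ T₂ := by
    intro C hC
    have hCfin : C.Finite := M.ground_finite.subset hC.1.subset_ground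
    obtain ⟨u, v, huv, hCx⟩ : ∃ u v, u ≠ v ∧ C \ {x} = {u, v} := by
      have h := ncard_sdiff_singleton_add_one hC.2.2 hCfin
      rw [hC.2.1] at h
      obtain ⟨u, v, huv, heq⟩ := ncard_eq_two.1 (show (C \ {x}).ncard = 2 by omega)
      exact ⟨u, v, huv, heq⟩
    have huCx : u ∈ C \ {x} := by rw [hCx]; exact mem_insert u {v}
    have hvCx : v ∈ C \ {x} := by rw [hCx]; exact mem_insert_of_mem u rfl
    have huC : u ∈ C := huCx.1
    have hvC : v ∈ C := hvCx.1
    have hux : u ≠ x := fun h => huCx.2 (mem_singleton_iff.2 h)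
    have hvx : v ≠ x := fun h => hvCx.2 (mem_singleton_iff.2 h)
    -- `C` does not meet `T` and `T₂` in two different points (the negated conclusion)
    have hnot : ∀ a ∈ C, a ∈ T → ∀ b ∈ C, b ∈ T₂ → a = b := by
      intro a ha haT b hb hbT₂
      by_contra hab
      exact hcon ⟨C, hC, a, ha, haT, b, hb, hbT₂, hab⟩
    by_cases huT : u ∈ T
    · refine ⟨v, hvC, hvx, ?_, ?_⟩
      · intro hvT; exact huv (hmeet C hC T hT hxT u huC v hvC huT hvT)
      · intro hvT₂; exact huv (hnot u huC huT v hvC hvT₂)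
    by_cases hvT : v ∈ T
    · refine ⟨u, huC, hux, huT, ?_⟩
      intro huT₂; exact huv (hnot v hvC hvT u huC huT₂).symm
    by_cases huT₂ : u ∈ T₂
    · refine ⟨v, hvC, hvx, hvT, ?_⟩
      intro hvT₂; exact huv (hmeet C hC T₂ hT₂ hxT₂ u huC v hvC huT₂ hvT₂)
    exact ⟨u, huC, hux, huT, huT₂⟩
  haveI : Nonempty α := ⟨x⟩
  choose! g hg using hchoice
  have hTfin' : (ThmN.trianglesThrough M x).Finite :=
    M.ground_finite.finite_subsets.subset (fun C hC => hC.1.subset_ground)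
  set B : Set α := g '' (ThmN.trianglesThrough M x) with hB
  have hBE : B ⊆ M.E := by
    rintro b ⟨C, hC, rfl⟩
    exact hC.1.subset_ground (hg C hC).1
  have hTB : Disjoint T B := by
    rw [disjoint_right]
    rintro b ⟨C, hC, rfl⟩
    exact (hg C hC).2.2.1
  have hT₂B : Disjoint T₂ B := by
    rw [disjoint_right]
    rintro b ⟨C, hC, rfl⟩
    exact (hg C hC).2.2.2
  -- `g` is injective: `g C = g C' ∈ C ∩ C'` forces `C = C'`
  have hginj : InjOn g (ThmN.trianglesThrough M x) := by
    intro C hC C' hC' h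
    by_contra hne'
    have hint := ThmN.inter_eq_singleton_of_mem_trianglesThrough M hC1 hC hC' hne'
    have hmem : g C ∈ C ∩ C' := ⟨(hg C hC).1, h ▸ (hg C' hC').1⟩
    rw [hint] at hmem
    exact (hg C hC).2.1 (mem_singleton_iff.1 hmem)
  have hBcard : B.ncard = (ThmN.trianglesThrough M x).ncard := hginj.ncard_image
  -- every deleted point lies in the closure of the rest: `g C ∈ cl (C ∖ {g C})`, `C ∖ {g C} ⊆ E ∖ B`
  have hBcl : B ⊆ M.closure (M.E \ B) := by
    rintro b ⟨C, hC, rfl⟩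
    have h1 := hC.1.mem_closure_sdiff_singleton_of_mem (hg C hC).1
    refine M.closure_subset_closure ?_ h1
    intro z hz
    refine ⟨hC.1.subset_ground hz.1, ?_⟩
    rintro ⟨C', hC', hgC'⟩
    by_cases hCC' : C = C'
    · subst hCC'; exact hz.2 (mem_singleton_iff.2 hgC'.symm)
    · have hint := ThmN.inter_eq_singleton_of_mem_trianglesThrough M hC1 hC hC' hCC'
      have hmem : z ∈ C ∩ C' := ⟨hz.1, hgC' ▸ (hg C' hC').1⟩
      rw [hint] at hmem
      exact (hg C' hC').2.1 (hgC'.trans (mem_singleton_iff.1 hmem))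
  -- the deletion keeps the rank
  set K := M ＼ B with hK
  have hKE : K.E = M.E \ B := Matroid.delete_ground M B
  have hKrank : K.eRank = M.eRank := by
    rw [Matroid.eRank_def, Matroid.eRank_def, hKE, hK, Matroid.delete_eq_restrict,
      Matroid.restrict_eRk_eq _ (subset_refl _)]
    apply le_antisymm (M.eRk_mono sdiff_subset)
    have hsub : M.E ⊆ M.closure (M.E \ B) := by
      intro z hz
      by_cases hzB : z ∈ B
      · exact hBcl hzB
      · exact M.subset_closure (M.E \ B) sdiff_subset ⟨hz, hzB⟩
    calc M.eRk M.E ≤ M.eRk (M.closure (M.E \ B)) := M.eRk_mono hsub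
      _ = M.eRk (M.E \ B) := M.eRk_closure_eq _
  -- the nullity of `K` is `d − |B| = 1`
  have hKd : K.E.encard = K.eRank + ((d - B.ncard : ℕ) : ℕ∞) := by
    rw [hKrank, hKE]
    have hrfin : M.eRank ≠ ⊤ := PercRepro.Matroid.eRank_ne_top_of_finite M
    obtain ⟨r, hr⟩ := ENat.ne_top_iff_exists.1 hrfin
    have hEn : M.E.ncard = r + d := by
      have h := hd
      rw [← hr, ← M.ground_finite.cast_ncard_eq] at h
      exact_mod_cast h
    have hcard : (M.E \ B).ncard + B.ncard = M.E.ncard := ncard_sdiff_add_ncard_of_subset hBE M.ground_finite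
    rw [← hr, ← (M.ground_finite.subset sdiff_subset).cast_ncard_eq]
    have hBd : B.ncard ≤ d := by rw [hBcard]; omega
    have : (M.E \ B).ncard = r + (d - B.ncard) := by omega
    rw [this]; push_cast; rfl
  have hd1 : d - B.ncard = 1 := by rw [hBcard]; omega
  rw [hd1] at hKd
  -- `T` and `T₂` are circuits of `K`: two circuits, nullity `1`
  have hTK : K.IsCircuit T := Matroid.delete_isCircuit_iff.2 ⟨hT.1, hTB⟩
  have hT₂K : K.IsCircuit T₂ := Matroid.delete_isCircuit_iff.2 ⟨hT₂.1, hT₂B⟩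
  have := two_le_of_two_circuits K hT₂K hTK hne hKd
  omega

end S1

end PercRepro
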